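import Mathlib

/-!
# `TriangularDimersDivisionEasy` — negative-side toolkit 1: a verified perfect-matching search

Crux `stmt-ValiantsHypothesis-5067` (`Theses.DivisionGap.TriangularDimersDivisionEasy`, route
DivisionGap).  Standing disprover (cdisprove gen 1), support for the load-bearing lemma
`false_without_division` (Valiant's monotone lower bound, `Cruxes/…/Disproof.lean` §E): the gadget
lemma there is verified by `native_decide` on the Boolean search `hasPM` below, whose correctness
(`hasPM_iff`) is proved here once and for all, for an arbitrary vertex type with a Boolean adjacency.

* `IsPMOn adj l f` — `f : V → V` is a perfect matching of the graph induced by `adj` on the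
  (duplicate-free) vertex list `l`: a fixed-point-free `adj`-involution on `l`, the identity off `l`.
* `hasPMFuel`, `hasPM` — depth-first search (match the head of the list with each later neighbour).
* `hasPM_iff` — for `l.Nodup`: `hasPM adj l = true ↔ ∃ f, IsPMOn adj l f`.
[folklore]
-/

namespace Summit.ValiantsHypothesis.ValiantsHypothesis.Theorems.TriangularDimersDivisionEasy.Negative

set_option linter.dupNamespace false

variable {V : Type*} [DecidableEq V]

/-- `f` is a perfect matching of the graph `adj` induced on the vertex list `l`: on `l` it is a
fixed-point-free involution along `adj`-edges staying inside `l`, and off `l` it is the identity.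
[folklore] -/
def IsPMOn (adj : V → V → Bool) (l : List V) (f : V → V) : Prop :=
  (∀ x ∈ l, f x ∈ l ∧ f x ≠ x ∧ f (f x) = x ∧ adj x (f x) = true) ∧ ∀ x, x ∉ l → f x = x

/-- Fuelled depth-first search for a perfect matching of the induced graph on a vertex list: match
the head with each later neighbour. [folklore] -/
def hasPMFuel (adj : V → V → Bool) : ℕ → List V → Bool
  | 0, _ => false
  | _ + 1, [] => true
  | k + 1, u :: rest => (rest.filter (adj u)).any fun w => hasPMFuel adj k (rest.erase w)

/-- Does the graph `adj` induced on the vertex list `l` have a perfect matching? [folklore] -/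
def hasPM (adj : V → V → Bool) (l : List V) : Bool :=
  hasPMFuel adj (l.length + 1) l

section Correctness

variable (adj : V → V → Bool)

/-- Swapping `u ↦ w`, `w ↦ u` on top of a matching of `rest.erase w` gives a matching of
`u :: rest`. [folklore] -/
theorem isPMOn_cons_of_erase {u w : V} {rest : List V} (hnd : (u :: rest).Nodup) (hw : w ∈ rest)
    (hadj : adj u w = true) (hsymm : ∀ x y, adj x y = adj y x) {g : V → V}
    (hg : IsPMOn adj (rest.erase w) g) :
    IsPMOn adj (u :: rest) (Function.update (Function.update g u w) w u) := by
  have hu : u ∉ rest := (List.nodup_cons.1 hnd).1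
  have hrnd : rest.Nodup := (List.nodup_cons.1 hnd).2
  have huw : u ≠ w := fun h => hu (h ▸ hw)
  have hw_not : w ∉ rest.erase w := List.Nodup.not_mem_erase hrnd
  have hu_not : u ∉ rest.erase w := fun h => hu (List.mem_of_mem_erase h)
  have hgu : g u = u := hg.2 u hu_not
  have hgw : g w = w := hg.2 w hw_not
  set f := Function.update (Function.update g u w) w u with hf
  have hfw : f w = u := by simp [f]
  have hfu : f u = w := by
    simp only [f, Function.update_apply, if_neg huw]; simp
  have hfx : ∀ x, x ≠ u → x ≠ w → f x = g x := by
    intro x hxu hxw; simp [f, hxu, hxw]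
  refine ⟨?_, ?_⟩
  · intro x hx
    rcases List.mem_cons.1 hx with rfl | hxr
    · refine ⟨by rw [hfu]; exact List.mem_cons_of_mem _ hw, by rw [hfu]; exact huw.symm,
        by rw [hfu, hfw], by rw [hfu]; exact hadj⟩
    · by_cases hxw : x = w
      · subst hxw
        refine ⟨by rw [hfw]; exact List.mem_cons_self, by rw [hfw]; exact huw,
          by rw [hfw, hfu], by rw [hfw, hsymm]; exact hadj⟩
      · have hxu : x ≠ u := fun h => hu (h ▸ hxr)
        have hxe : x ∈ rest.erase w := (List.mem_erase_of_ne hxw).2 hxr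
        obtain ⟨h1, h2, h3, h4⟩ := hg.1 x hxe
        have hgxu : g x ≠ u := fun h => hu_not (h ▸ h1)
        have hgxw : g x ≠ w := fun h => hw_not (h ▸ h1)
        rw [hfx x hxu hxw]
        refine ⟨List.mem_cons_of_mem _ (List.mem_of_mem_erase h1), h2, ?_, h4⟩
        rw [hfx (g x) hgxu hgxw, h3]
  · intro x hx
    have hxu : x ≠ u := fun h => hx (h ▸ List.mem_cons_self)
    have hxw : x ≠ w := fun h => hx (h ▸ List.mem_cons_of_mem _ hw)
    rw [hfx x hxu hxw]
    exact hg.2 x fun h => hx (List.mem_cons_of_mem _ (List.mem_of_mem_erase h))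

/-- Freezing `u` and `w = f u` in a matching `f` of `u :: rest` gives a matching of `rest.erase w`.
[folklore] -/
theorem isPMOn_erase_of_cons {u : V} {rest : List V} (hnd : (u :: rest).Nodup) {f : V → V}
    (hf : IsPMOn adj (u :: rest) f) :
    f u ∈ rest ∧ adj u (f u) = true ∧
      IsPMOn adj (rest.erase (f u)) (Function.update (Function.update f u u) (f u) (f u)) := by
  have hu : u ∉ rest := (List.nodup_cons.1 hnd).1
  have hrnd : rest.Nodup := (List.nodup_cons.1 hnd).2
  obtain ⟨h1, h2, h3, h4⟩ := hf.1 u List.mem_cons_self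
  set w := f u with hw
  have hwr : w ∈ rest := by
    rcases List.mem_cons.1 h1 with h | h
    · exact absurd h h2
    · exact h
  refine ⟨hwr, h4, ?_, ?_⟩
  · intro x hx
    have hxw : x ≠ w := fun h => (List.Nodup.not_mem_erase hrnd) (h ▸ hx)
    have hxr : x ∈ rest := List.mem_of_mem_erase hx
    have hxu : x ≠ u := fun h => hu (h ▸ hxr)
    obtain ⟨g1, g2, g3, g4⟩ := hf.1 x (List.mem_cons_of_mem _ hxr)
    have hfxu : f x ≠ u := by
      intro h; apply hxw
      have := congrArg f h; rw [g3] at this; exact this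
    have hfxw : f x ≠ w := by
      intro h; apply hxu
      have := congrArg f h; rw [g3, hw, h3] at this; exact this
    have e1 : Function.update (Function.update f u u) w w x = f x := by
      simp [hxu, hxw]
    have e2 : Function.update (Function.update f u u) w w (f x) = f (f x) := by
      simp [hfxu, hfxw]
    rw [e1, e2, g3]
    refine ⟨(List.mem_erase_of_ne hfxw).2 ?_, g2, rfl, g4⟩
    rcases List.mem_cons.1 g1 with h | h
    · exact absurd h hfxu
    · exact h
  · have huw : u ≠ w := by
      intro h; apply h2; rw [hw] at h; exact h.symm
    intro x hx
    by_cases hxw : x = w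
    · subst hxw; simp
    · by_cases hxu : x = u
      · rw [hxu]; simp [huw]
      · have hxr : x ∉ rest := fun h => hx ((List.mem_erase_of_ne hxw).2 h)
        have : x ∉ u :: rest := by
          intro h; rcases List.mem_cons.1 h with h | h
          · exact hxu h
          · exact hxr h
        simp [hxu, hxw, hf.2 x this]

/-- **Correctness of the search** (with enough fuel). [folklore] -/
theorem hasPMFuel_iff (hsymm : ∀ x y, adj x y = adj y x) :
    ∀ (k : ℕ) (l : List V), l.Nodup → l.length + 1 ≤ k →
      (hasPMFuel adj k l = true ↔ ∃ f, IsPMOn adj l f) := by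
  intro k
  induction k with
  | zero => intro l _ hk; simp at hk
  | succ k ih =>
    intro l hnd hk
    cases l with
    | nil =>
      simp only [hasPMFuel, true_iff]
      exact ⟨id, by simp [IsPMOn]⟩
    | cons u rest =>
      simp only [hasPMFuel, List.any_eq_true, List.mem_filter]
      have hrnd : rest.Nodup := (List.nodup_cons.1 hnd).2
      have hlen : ∀ w ∈ rest, (rest.erase w).length + 1 ≤ k := by
        intro w hw
        rw [List.length_erase_of_mem hw]
        have : (u :: rest).length = rest.length + 1 := rfl
        have h1 : 1 ≤ rest.length := List.length_pos_of_mem hw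
        omega
      constructor
      · rintro ⟨w, ⟨hw, hadj⟩, hrec⟩
        obtain ⟨g, hg⟩ := (ih (rest.erase w) (hrnd.erase w) (hlen w hw)).1 hrec
        exact ⟨_, isPMOn_cons_of_erase adj hnd hw hadj hsymm hg⟩
      · rintro ⟨f, hf⟩
        obtain ⟨hwr, hadj, hg⟩ := isPMOn_erase_of_cons adj hnd hf
        exact ⟨f u, ⟨hwr, hadj⟩, (ih (rest.erase (f u)) (hrnd.erase _) (hlen _ hwr)).2 ⟨_, hg⟩⟩

/-- **Correctness of `hasPM`.** For a duplicate-free vertex list, the search succeeds iff the induced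
graph has a perfect matching. [folklore] -/
theorem hasPM_iff (hsymm : ∀ x y, adj x y = adj y x) {l : List V} (hnd : l.Nodup) :
    hasPM adj l = true ↔ ∃ f, IsPMOn adj l f :=
  hasPMFuel_iff adj hsymm _ l hnd le_rfl

omit [DecidableEq V] in
/-- A perfect matching of `l` restricts to a bijection of `l`; in particular it is injective on `l`
and two matched vertices determine each other. [folklore] -/
theorem IsPMOn.apply_eq_iff {adj : V → V → Bool} {l : List V} {f : V → V} (hf : IsPMOn adj l f)
    {x y : V} (hx : x ∈ l) : f x = y ↔ f y = x ∧ y ∈ l := by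
  constructor
  · rintro rfl; exact ⟨(hf.1 x hx).2.2.1, (hf.1 x hx).1⟩
  · rintro ⟨h, hy⟩; rw [← h, (hf.1 y hy).2.2.1]


omit [DecidableEq V] in
/-- `IsPMOn` depends on the vertex list only through its members. [folklore] -/
theorem IsPMOn.of_mem_iff {adj : V → V → Bool} {l l' : List V} {f : V → V}
    (h : ∀ x, x ∈ l ↔ x ∈ l') (hf : IsPMOn adj l f) : IsPMOn adj l' f := by
  refine ⟨fun x hx => ?_, fun x hx => hf.2 x fun hx' => hx ((h x).1 hx')⟩
  obtain ⟨h1, h2, h3, h4⟩ := hf.1 x ((h x).2 hx)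
  exact ⟨(h _).1 h1, h2, h3, h4⟩

/-- Adding a matched pair of two fresh adjacent vertices. [folklore] -/
theorem IsPMOn.insert_pair {l : List V} (hl : l.Nodup) {f : V → V} (hf : IsPMOn adj l f) {a b : V}
    (ha : a ∉ l) (hb : b ∉ l) (hab : a ≠ b) (hadj : adj a b = true)
    (hsymm : ∀ x y, adj x y = adj y x) :
    IsPMOn adj (a :: b :: l) (Function.update (Function.update f a b) b a) := by
  have key : IsPMOn adj ((b :: l).erase b) f := by
    rw [List.erase_cons_head]; exact hf
  have hnd : a ∉ b :: l := by
    intro h; rcases List.mem_cons.1 h with h | h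
    · exact hab h
    · exact ha h
  -- reuse the cons lemma with `u = a`, `w = b`, `rest = b :: l`
  exact isPMOn_cons_of_erase adj (u := a) (w := b) (rest := b :: l)
    (List.nodup_cons.2 ⟨hnd, List.nodup_cons.2 ⟨hb, hl⟩⟩) List.mem_cons_self hadj hsymm key

/-- A perfectly matched duplicate-free list has even length. [folklore] -/
theorem IsPMOn.even_length_aux :
    ∀ (k : ℕ) (l : List V), l.length ≤ k → l.Nodup → ∀ {f : V → V}, IsPMOn adj l f → Even l.length := by
  intro k
  induction k with
  | zero =>
    intro l hl _ _ _
    have : l = [] := List.eq_nil_of_length_eq_zero (Nat.le_zero.1 hl)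
    subst this; simp
  | succ k ih =>
    intro l hl hnd f hf
    cases l with
    | nil => simp
    | cons u rest =>
      obtain ⟨hwr, -, hg⟩ := isPMOn_erase_of_cons adj hnd hf
      have h1 : 0 < rest.length := List.length_pos_of_mem hwr
      have hlen : (rest.erase (f u)).length = rest.length - 1 := List.length_erase_of_mem hwr
      have hl' : (rest.erase (f u)).length ≤ k := by
        rw [hlen]; simp only [List.length_cons] at hl; omega
      have := ih (rest.erase (f u)) hl' ((List.nodup_cons.1 hnd).2.erase _) hg
      rw [hlen] at this
      obtain ⟨m, hm⟩ := this
      exact ⟨m + 1, by simp only [List.length_cons]; omega⟩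

/-- A perfectly matched duplicate-free list has even length. [folklore] -/
theorem IsPMOn.even_length {l : List V} (hnd : l.Nodup) {f : V → V} (hf : IsPMOn adj l f) :
    Even l.length :=
  IsPMOn.even_length_aux adj l.length l le_rfl hnd hf

end Correctness

end Summit.ValiantsHypothesis.ValiantsHypothesis.Theorems.TriangularDimersDivisionEasy.Negative
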